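import Literature.NumberTheory.DiophantineGeometry.GenEllPullbackConductor
import Literature.NumberTheory.NumberFields.DedekindDifferentBoundGeneral
import Mathlib.RingTheory.DedekindDomain.Factorization
import HarnessLib

/-!
# [GenEll] Proposition 1.7 (i): the right inequality in the printed `(1 − 1/e)` form (tame case)

S. Mochizuki, *Arithmetic elliptic curves in general position*, Math. J. Okayama Univ. 52 (2010)
[cite: MochizukiGenEll2010], Proposition 1.7 (i) pp. 9–10, read on the page: for `φ : Y → Z`
generically finite between normal `ℤ`-proper `ℤ`-flat surfaces, `e ≥ 1`, and `ℤ`-flat divisors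
`D ⊆ Y`, `E ⊆ Z` with (a) `D_ℚ, E_ℚ` reduced, (b) `D_ℚ = φ⁻¹(E_ℚ)_red`, (c) `φ_ℚ` finite étale over
`U_Z = Z ∖ E`, (d) every ramification index of `φ_ℚ` at `D_ℚ` divides `e`:
"`log-cond_E − log-cond_D ≲ log-diff_Y − log-diff_Z ≲ (1 − 1/e) · log-cond_E` on `U_Y(Q̄)`".
Printed proof of the RIGHT inequality (p. 10): outside a finite set `Σ` of primes `Y → Z` is "a
finite tamely ramified morphism of smooth, proper families of curves", so "the "prime-to-`Σ` portion"
of the inequality `log-cond_E − log-cond_D = log-diff_Y − log-diff_Z ≤ (1 − e⁻¹) · log-cond_E` [i.e.,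
with "`=`" and "`≤`", not "`≲`"!] follows immediately from the elementary theory of differents", and
"it suffices to show that the "portion over `Σ`" of the quantity `log-diff_Y − log-diff_Z` is bounded".

This file PROVES the number-field content of that argument for an ARBITRARY finite extension of
number fields `K ⊆ L` (no Galois hypothesis; the companion `GenEllDifferentUpperBound` is the Galois
case with coefficient `1` on the conductor drop), in the printed `(1 − 1/e)` shape: for a finite set
`S` of primes of `K`, a finite set `B` of rational primes (print's `Σ`) and `e ≥ 1`, IF every prime
`w` of `L` of residue characteristic `∉ B` is unramified over `K` when `w ∩ 𝓞_K ∉ S` and TAMELY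
ramified with index `≤ e` when `w ∩ 𝓞_K ∈ S` (hypotheses (b)–(d) read through the tame model), THEN
`logdisc L − logdisc K ≤ (1 − 1/e)·(1/[K:ℚ])·Σ_{v∈S} log N(v) + (Σ_{p∈B} log p + log [L:K]!)`
(`logdisc_sub_logdisc_le_tame`; `NFPoint` form `NFPoint.logDiff_sub_logDiff_le_one_sub_inv_mul_logCond`:
`log-diff(y) − log-diff(x) ≤ (1 − 1/e)·log-cond_C(x) + C(B, [Q.F:P.F])`).  Per prime `w` of `L`:
prime to `B`, `ord_w 𝔇_{L/K} ≤ e_w − 1` (tame: Serre III §6 Prop. 13, the tree's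
`multiplicity_differentIdeal_le_of_not_dvd`; `= 0` when `w ∩ 𝓞_K ∉ S`), and at `v ∈ S`
`Σ_{w∣v} (e_w − 1) log N(w) ≤ (1 − 1/e)·[L:K]·log N(v)` (`e_w − 1 ≤ (1 − 1/e)·e_w` for `e_w ≤ e`,
`Σ_{w∣v} e_w f_w = [L:K]`; `sum_ramificationIdx_sub_one_mul_log_le`); over `B`,
`ord_w 𝔇_{L/K} ≤ e_w − 1 + ord_w(e_w)` for EVERY extension (Dedekind–Hensel, the tree's
`multiplicity_differentIdeal_succ_le`), `e_w ≤ e(w|p) = ord_w(p)` and `e_w ∣ [L:K]!`, so the portion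
over `B` of `log N(𝔇_{L/K})` is `≤ [L:ℚ]·(Σ_{p∈B} log p + log [L:K]!)`.
NOT here (`TODO(general form)`): the GEOMETRIC input producing the two hypotheses from a tame model of
`φ` over `ℤ[Σ⁻¹]` (Abhyankar's lemma at the points of `D`); curves other than `ℙ¹` in the `NFPoint`
form.  Classical; no bearing on, and no side taken on, [IUTchIII] Cor. 3.12.  Theorems only.
-/

noncomputable section

open NumberField IsDedekindDomain Ideal Module

namespace Literature.NumberTheory.DiophantineGeometry.GenEll

section Factorisation

variable (L : Type*) [Field L] [NumberField L]

/-- `log N(I) = Σ_{w ∈ T} v_w(I)·log N(w)` for a nonzero ideal `I` of `𝓞_L` and any finite set `T`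
of primes containing those with `v_w(I) ≠ 0`. [folklore] -/
private theorem log_absNorm_eq_sum_mul_log {I : Ideal (𝓞 L)} (hI : I ≠ ⊥)
    (T : Finset (HeightOneSpectrum (𝓞 L)))
    (hT : ∀ w : HeightOneSpectrum (𝓞 L), multiplicity w.asIdeal I ≠ 0 → w ∈ T) :
    Real.log (absNorm I : ℝ) =
      ∑ w ∈ T, (multiplicity w.asIdeal I : ℝ) * Real.log (absNorm w.asIdeal : ℝ) := by
  have hfac := Ideal.finprod_heightOneSpectrum_pow_multiplicity hI
  have hsupp : (Function.mulSupport fun w : HeightOneSpectrum (𝓞 L) =>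
      w.asIdeal ^ multiplicity w.asIdeal I) ⊆ T := fun w hw =>
    hT w fun h0 => hw (show w.asIdeal ^ multiplicity w.asIdeal I = 1 by rw [h0, pow_zero])
  rw [finprod_eq_prod_of_mulSupport_subset _ hsupp] at hfac
  conv_lhs => rw [← hfac, map_prod, Nat.cast_prod]
  rw [Real.log_prod]
  · refine Finset.sum_congr rfl fun w _ => ?_
    rw [map_pow, Nat.cast_pow, Real.log_pow]
  · intro w _
    rw [map_pow, Nat.cast_pow]
    exact pow_ne_zero _ (Nat.cast_ne_zero.mpr (by rw [Ne, Ideal.absNorm_eq_zero_iff]; exact w.ne_bot))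

/-- `Σ_{w ∈ T} v_w(I)·log N(w) ≤ log N(I)` for every finite set `T` of primes. [folklore] -/
private theorem sum_mul_log_le_log_absNorm {I : Ideal (𝓞 L)} (hI : I ≠ ⊥)
    (T : Finset (HeightOneSpectrum (𝓞 L))) :
    ∑ w ∈ T, (multiplicity w.asIdeal I : ℝ) * Real.log (absNorm w.asIdeal : ℝ) ≤
      Real.log (absNorm I : ℝ) := by
  classical
  have hfin : {w : HeightOneSpectrum (𝓞 L) | multiplicity w.asIdeal I ≠ 0}.Finite := by
    refine (Ideal.finite_factors hI).subset fun w hw => ?_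
    simp only [Set.mem_setOf_eq] at hw ⊢
    exact (dvd_pow_self w.asIdeal hw).trans (pow_multiplicity_dvd w.asIdeal I)
  rw [log_absNorm_eq_sum_mul_log L hI (T ∪ hfin.toFinset)
    (fun w hw => Finset.mem_union_right _ (hfin.mem_toFinset.mpr hw))]
  refine Finset.sum_le_sum_of_subset_of_nonneg Finset.subset_union_left fun w _ _ =>
    mul_nonneg (Nat.cast_nonneg _) (Real.log_nonneg ?_)
  exact_mod_cast Nat.one_le_iff_ne_zero.mpr (by rw [Ne, Ideal.absNorm_eq_zero_iff]; exact w.ne_bot)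

/-- `log N(k·𝒪_L) = [L:ℚ]·log k` for a natural number `k`. [folklore] -/
private theorem log_absNorm_span_natCast (k : ℕ) :
    Real.log (absNorm (Ideal.span {((k : ℕ) : 𝓞 L)}) : ℝ) = finrank ℚ L * Real.log k := by
  rw [Ideal.absNorm_span_singleton, show ((k : ℕ) : 𝓞 L) = algebraMap ℤ (𝓞 L) (k : ℤ) by simp,
    Algebra.norm_algebraMap, NumberField.RingOfIntegers.rank, Int.natAbs_pow, Int.natAbs_natCast,
    Nat.cast_pow, Real.log_pow]

/-- For the primes `w ∈ T` of a fixed residue characteristic `p`: `Σ v_w(p)·log N(w) ≤ [L:ℚ]·log p`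
(part of the factorisation of `p·𝒪_L`; for `p = 0` the sum is empty). [folklore] -/
private theorem sum_filter_residueChar_mul_log_le (T : Finset (HeightOneSpectrum (𝓞 L))) (p : ℕ) :
    ∑ w ∈ T with absNorm (w.asIdeal.under ℤ) = p,
        (multiplicity w.asIdeal (Ideal.span {((p : ℕ) : 𝓞 L)}) : ℝ) *
          Real.log (absNorm w.asIdeal : ℝ) ≤ finrank ℚ L * Real.log p := by
  classical
  by_cases hp : p = 0
  · have hempty : T.filter (fun w => absNorm (w.asIdeal.under ℤ) = p) = ∅ := by
      refine Finset.filter_eq_empty_iff.mpr fun w _ h => ?_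
      haveI : NeZero w.asIdeal := ⟨w.ne_bot⟩
      exact (Nat.absNorm_under_prime w.asIdeal).ne_zero (h.trans hp)
    rw [hempty, Finset.sum_empty, hp, Nat.cast_zero, Real.log_zero, mul_zero]
  · rw [← log_absNorm_span_natCast L p]
    exact sum_mul_log_le_log_absNorm L (by
      rw [Ne, Ideal.span_singleton_eq_bot]; exact_mod_cast hp) _

end Factorisation

section Engine

variable (K L : Type*) [Field K] [NumberField K] [Field L] [NumberField L] [Algebra K L]

omit [NumberField K] [NumberField L] in
/-- A prime `w` of `L` and the prime `w ∩ 𝓞_K` below it have the same residue characteristic.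
[folklore] -/
private theorem absNorm_under_int_eq (w : HeightOneSpectrum (𝓞 L)) :
    absNorm (w.asIdeal.under ℤ) = absNorm ((w.under (𝓞 K)).asIdeal.under ℤ) := by
  change absNorm (w.asIdeal.under ℤ) = absNorm ((w.asIdeal.under (𝓞 K)).under ℤ)
  rw [Ideal.under_under]

/-- **The tame local computation of [GenEll] Prop. 1.7 (i)** at one prime `v` of `K`: if every prime
`w` of `L` above `v` has ramification index `e_w ≤ e`, then
`Σ_{w∣v} (e_w − 1)·log N(w) ≤ (1 − 1/e)·[L:K]·log N(v)` (`e_w − 1 ≤ (1 − 1/e)·e_w`,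
`log N(w) = f_w·log N(v)`, `Σ_{w∣v} e_w f_w = [L:K]`). [cite: MochizukiGenEll2010, Prop 1.7 (i) p.10] -/
theorem sum_ramificationIdx_sub_one_mul_log_le {v : Ideal (𝓞 K)} (hv : v ≠ ⊥) [v.IsMaximal]
    {e : ℕ} (he : 0 < e)
    (hle : ∀ w ∈ IsDedekindDomain.primesOverFinset v (𝓞 L), w.ramificationIdx (𝓞 K) ≤ e) :
    ∑ w ∈ IsDedekindDomain.primesOverFinset v (𝓞 L),
        ((w.ramificationIdx (𝓞 K) : ℝ) - 1) * Real.log (absNorm w : ℝ) ≤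
      (1 - (e : ℝ)⁻¹) * ((finrank K L : ℝ) * Real.log (absNorm v : ℝ)) := by
  have hcast : (finrank K L : ℝ) = ∑ w ∈ IsDedekindDomain.primesOverFinset v (𝓞 L),
      (ramificationIdx' v w : ℝ) * (inertiaDeg' v w : ℝ) := by
    rw [← Ideal.sum_ramification_inertia (R := 𝓞 K) (𝓞 L) K L hv]; push_cast; rfl
  rw [hcast, Finset.sum_mul, Finset.mul_sum]
  refine Finset.sum_le_sum fun w hw => ?_
  have h := (IsDedekindDomain.mem_primesOverFinset_iff hv (𝓞 L)).mp hw
  haveI := h.1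
  haveI := h.2
  rw [log_absNorm_eq_inertiaDeg_mul K L hv hw, Ideal.ramificationIdx'_eq_ramificationIdx v w hv]
  have he' : (0 : ℝ) < e := by exact_mod_cast he
  have hew : (w.ramificationIdx (𝓞 K) : ℝ) ≤ e := by exact_mod_cast hle w hw
  have hf : (0 : ℝ) ≤ inertiaDeg' v w := Nat.cast_nonneg _
  have hlog : (0 : ℝ) ≤ Real.log (absNorm v : ℝ) := Real.log_nonneg (by
    exact_mod_cast Nat.one_le_iff_ne_zero.mpr (by rw [Ne, Ideal.absNorm_eq_zero_iff]; exact hv))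
  have key : (w.ramificationIdx (𝓞 K) : ℝ) - 1 ≤ (1 - (e : ℝ)⁻¹) * w.ramificationIdx (𝓞 K) := by
    rw [sub_mul, one_mul, sub_le_sub_iff_left, inv_mul_le_iff₀ he', mul_one]; exact hew
  calc ((w.ramificationIdx (𝓞 K) : ℝ) - 1) * ((inertiaDeg' v w : ℝ) * Real.log (absNorm v : ℝ))
      ≤ ((1 - (e : ℝ)⁻¹) * w.ramificationIdx (𝓞 K)) *
          ((inertiaDeg' v w : ℝ) * Real.log (absNorm v : ℝ)) :=
        mul_le_mul_of_nonneg_right key (mul_nonneg hf hlog)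
    _ = (1 - (e : ℝ)⁻¹) * ((w.ramificationIdx (𝓞 K) : ℝ) * (inertiaDeg' v w : ℝ) *
          Real.log (absNorm v : ℝ)) := by ring

/-- **[GenEll] Prop. 1.7 (i), RIGHT inequality — number-field content, printed `(1 − 1/e)` form, for
an ARBITRARY finite extension `L/K` of number fields.**  For a finite set `S` of primes of `K`, a finite
set `B ⊆ ℕ` (print's `Σ`) and `e ≥ 1`: if every prime `w` of `L` of residue characteristic `∉ B` is
unramified over `K` when `w ∩ 𝓞_K ∉ S` (`hunr`) and tamely ramified with index `≤ e` when
`w ∩ 𝓞_K ∈ S` (`htame`), then `(1/[L:ℚ])·log|disc L| − (1/[K:ℚ])·log|disc K| ≤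
(1 − 1/e)·(1/[K:ℚ])·Σ_{v∈S} log N(v) + (Σ_{p∈B} log p + log [L:K]!)` ("`≤ (1 − e⁻¹)·log-cond_E`"
prime to `Σ`, plus a bound over `Σ` by `Σ` and the degree). [cite: MochizukiGenEll2010, Prop 1.7 (i) p.10] -/
theorem logdisc_sub_logdisc_le_tame (S : Finset (HeightOneSpectrum (𝓞 K))) (B : Finset ℕ)
    {e : ℕ} (he : 0 < e)
    (hunr : ∀ w : HeightOneSpectrum (𝓞 L), absNorm (w.asIdeal.under ℤ) ∉ B →
      w.under (𝓞 K) ∉ S → w.asIdeal.ramificationIdx (𝓞 K) = 1)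
    (htame : ∀ w : HeightOneSpectrum (𝓞 L), absNorm (w.asIdeal.under ℤ) ∉ B →
      w.under (𝓞 K) ∈ S → w.asIdeal.ramificationIdx (𝓞 K) ≤ e ∧
        ¬ (absNorm (w.asIdeal.under ℤ) ∣ w.asIdeal.ramificationIdx (𝓞 K))) :
    (finrank ℚ L : ℝ)⁻¹ * Real.log ((discr L).natAbs : ℝ) -
        (finrank ℚ K : ℝ)⁻¹ * Real.log ((discr K).natAbs : ℝ) ≤
      (1 - (e : ℝ)⁻¹) * ((finrank ℚ K : ℝ)⁻¹ * ∑ v ∈ S, Real.log (absNorm v.asIdeal : ℝ)) +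
        (∑ p ∈ B, Real.log (p : ℝ) + Real.log ((finrank K L).factorial : ℝ)) := by
  classical
  set D := differentIdeal (𝓞 K) (𝓞 L) with hD_def
  have hD : D ≠ ⊥ := differentIdeal_ne_bot
  set n := finrank K L with hn_def
  have hK0 : (finrank ℚ K : ℝ) ≠ 0 := by exact_mod_cast finrank_pos.ne'
  have hn0 : (n : ℝ) ≠ 0 := by exact_mod_cast finrank_pos.ne'
  have hLpos : (0 : ℝ) < finrank ℚ L := by exact_mod_cast finrank_pos
  have htower : (finrank ℚ L : ℝ) = finrank ℚ K * n := by
    exact_mod_cast (finrank_mul_finrank ℚ K L).symm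
  -- the finite set `T` of primes: those dividing `𝔇` together with all primes above `S`
  have hfin₁ : {w : HeightOneSpectrum (𝓞 L) | multiplicity w.asIdeal D ≠ 0}.Finite := by
    refine (Ideal.finite_factors hD).subset fun w hw => ?_
    simp only [Set.mem_setOf_eq] at hw ⊢
    exact (dvd_pow_self w.asIdeal hw).trans (pow_multiplicity_dvd w.asIdeal D)
  have hfin₂ : {w : HeightOneSpectrum (𝓞 L) | w.under (𝓞 K) ∈ S}.Finite := by
    have : {w : HeightOneSpectrum (𝓞 L) | w.under (𝓞 K) ∈ S} ⊆
        ⋃ v ∈ S, {w : HeightOneSpectrum (𝓞 L) | w.asIdeal ∈ v.asIdeal.primesOver (𝓞 L)} := by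
      intro w hw
      simp only [Set.mem_setOf_eq, Set.mem_iUnion] at hw ⊢
      exact ⟨w.under (𝓞 K), hw, w.isPrime, ⟨rfl⟩⟩
    refine Set.Finite.subset (Set.Finite.biUnion S.finite_toSet fun v _ => ?_) this
    exact (IsDedekindDomain.primesOver_finite v.asIdeal (𝓞 L)).preimage
      (fun w _ w' _ h => HeightOneSpectrum.ext h)
  set T : Finset (HeightOneSpectrum (𝓞 L)) := (hfin₁.union hfin₂).toFinset with hT_def
  have hT₁ : ∀ w, multiplicity w.asIdeal D ≠ 0 → w ∈ T := fun w hw =>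
    (hfin₁.union hfin₂).mem_toFinset.mpr (Or.inl hw)
  have hT₂ : ∀ w : HeightOneSpectrum (𝓞 L), w.under (𝓞 K) ∈ S → w ∈ T := fun w hw =>
    (hfin₁.union hfin₂).mem_toFinset.mpr (Or.inr hw)
  have hlogN : ∀ w : HeightOneSpectrum (𝓞 L), 0 ≤ Real.log (absNorm w.asIdeal : ℝ) := fun w =>
    Real.log_nonneg (Nat.one_le_cast.mpr (Nat.one_le_iff_ne_zero.mpr (absNorm_eq_zero_iff.not.mpr w.ne_bot)))
  have hmax : ∀ w : HeightOneSpectrum (𝓞 L), w.asIdeal.IsMaximal := fun w =>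
    w.isPrime.isMaximal w.ne_bot
  -- `χ w` = residue characteristic, `g w = ord_w(𝔇)·log N(w)`, `g' w = (e_w − 1)·log N(w)`
  let χ : HeightOneSpectrum (𝓞 L) → ℕ := fun w => absNorm (w.asIdeal.under ℤ)
  set g : HeightOneSpectrum (𝓞 L) → ℝ := fun w =>
    (multiplicity w.asIdeal D : ℝ) * Real.log (absNorm w.asIdeal : ℝ) with hg_def
  set g' : HeightOneSpectrum (𝓞 L) → ℝ := fun w =>
    ((w.asIdeal.ramificationIdx (𝓞 K) : ℝ) - 1) * Real.log (absNorm w.asIdeal : ℝ) with hg'_def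
  -- step 1: `log N(𝔇) = Σ_T g`, split into the portion over `B` and the prime-to-`B` portion
  have h1 : Real.log (absNorm D : ℝ) = ∑ w ∈ T, g w := log_absNorm_eq_sum_mul_log L hD T hT₁
  have hsplit : ∑ w ∈ T, g w = ∑ w ∈ T with χ w ∈ B, g w + ∑ w ∈ T with χ w ∉ B, g w :=
    (Finset.sum_filter_add_sum_filter_not T (fun w => χ w ∈ B) g).symm
  -- step 2: prime to `B`, `ord_w 𝔇 ≤ e_w − 1` (tame; `e_w = 1` if `w ∩ 𝓞_K ∉ S`)
  have h2 : ∀ w ∈ T.filter (fun w => χ w ∉ B), g w ≤ g' w := by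
    intro w hw
    have hwB : χ w ∉ B := (Finset.mem_filter.mp hw).2
    haveI := hmax w
    refine mul_le_mul_of_nonneg_right ?_ (hlogN w)
    have he1 : 1 ≤ w.asIdeal.ramificationIdx (𝓞 K) := Ideal.ramificationIdx_pos w.asIdeal (𝓞 K)
    have hnd : ¬ (χ w ∣ w.asIdeal.ramificationIdx (𝓞 K)) := by
      by_cases hwS : w.under (𝓞 K) ∈ S
      · exact (htame w hwB hwS).2
      · rw [hunr w hwB hwS, Nat.dvd_one]
        haveI : NeZero w.asIdeal := ⟨w.ne_bot⟩
        exact (Nat.absNorm_under_prime w.asIdeal).ne_one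
    have hle := Literature.NumberTheory.NumberFields.multiplicity_differentIdeal_le_of_not_dvd
      K L w.asIdeal hnd
    have : (multiplicity w.asIdeal D : ℝ) ≤ ((w.asIdeal.ramificationIdx (𝓞 K) - 1 : ℕ) : ℝ) := by
      exact_mod_cast hle
    rwa [Nat.cast_sub he1, Nat.cast_one] at this
  -- step 3: the prime-to-`B` portion is at most `(1 − 1/e)·n·Σ_{v∈S} log N(v)`
  have htame_le : ∑ w ∈ T with χ w ∉ B, g w ≤
      (1 - (e : ℝ)⁻¹) * ((n : ℝ) * ∑ v ∈ S, Real.log (absNorm v.asIdeal : ℝ)) := by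
    set S' : Finset (HeightOneSpectrum (𝓞 K)) :=
      S.filter fun v => absNorm (v.asIdeal.under ℤ) ∉ B with hS'_def
    have hS' : ∀ w : HeightOneSpectrum (𝓞 L), w.under (𝓞 K) ∈ S' ↔ w.under (𝓞 K) ∈ S ∧ χ w ∉ B :=
      fun w => by rw [hS'_def, Finset.mem_filter, ← absNorm_under_int_eq K L w]
    have hconc : ∑ w ∈ T with w.under (𝓞 K) ∈ S', g' w = ∑ w ∈ T with χ w ∉ B, g' w := by
      refine Finset.sum_subset (fun w hw => ?_) (fun w hw hw' => ?_)
      · obtain ⟨hwT, hwS'⟩ := Finset.mem_filter.mp hw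
        exact Finset.mem_filter.mpr ⟨hwT, ((hS' w).mp hwS').2⟩
      · obtain ⟨hwT, hwB⟩ := Finset.mem_filter.mp hw
        have hwS : w.under (𝓞 K) ∉ S := fun h =>
          hw' (Finset.mem_filter.mpr ⟨hwT, (hS' w).mpr ⟨h, hwB⟩⟩)
        simp only [hg'_def, hunr w hwB hwS, Nat.cast_one, sub_self, zero_mul]
    have hfib : ∀ v ∈ S', ((T.filter fun w => w.under (𝓞 K) ∈ S').filter
        fun w => w.under (𝓞 K) = v) = T.filter fun w => w.under (𝓞 K) = v := by
      intro v hv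
      ext w
      simp only [Finset.mem_filter]
      exact ⟨fun ⟨⟨hT, _⟩, hv'⟩ => ⟨hT, hv'⟩, fun ⟨hT, hv'⟩ => ⟨⟨hT, hv' ▸ hv⟩, hv'⟩⟩
    have h3b : ∑ w ∈ T with w.under (𝓞 K) ∈ S', g' w =
        ∑ v ∈ S', ∑ w ∈ T with w.under (𝓞 K) = v, g' w := by
      rw [← Finset.sum_fiberwise_of_maps_to (s := T.filter fun w => w.under (𝓞 K) ∈ S')
        (t := S') (g := fun w => w.under (𝓞 K)) (fun w hw => (Finset.mem_filter.mp hw).2) g']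
      exact Finset.sum_congr rfl fun v hv => by rw [hfib v hv]
    have h3c : ∀ v ∈ S', ∑ w ∈ T with w.under (𝓞 K) = v, g' w ≤
        (1 - (e : ℝ)⁻¹) * ((n : ℝ) * Real.log (absNorm v.asIdeal : ℝ)) := by
      intro v hv
      obtain ⟨hvS, hvB⟩ := Finset.mem_filter.mp hv
      haveI := v.isMaximal
      rw [sum_filter_under_eq_sum_primesOverFinset K L v T (fun w hw => hT₂ w (hw ▸ hvS))
          (fun P => ((P.ramificationIdx (𝓞 K) : ℝ) - 1) * Real.log (absNorm P : ℝ))]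
      refine sum_ramificationIdx_sub_one_mul_log_le K L v.ne_bot he fun w hw => ?_
      have h := (IsDedekindDomain.mem_primesOverFinset_iff v.ne_bot (𝓞 L)).mp hw
      let w' : HeightOneSpectrum (𝓞 L) := ⟨w, h.1, ne_bot_of_mem_primesOver v.ne_bot h⟩
      haveI := h.2
      have hw'v : w'.under (𝓞 K) = v := HeightOneSpectrum.ext (Ideal.over_def w v.asIdeal).symm
      have hw'B : χ w' ∉ B := by
        simp only [χ, absNorm_under_int_eq K L w', hw'v]; exact hvB
      exact (htame w' hw'B (hw'v ▸ hvS)).1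
    have h3d : ∑ v ∈ S', (1 - (e : ℝ)⁻¹) * ((n : ℝ) * Real.log (absNorm v.asIdeal : ℝ)) ≤
        (1 - (e : ℝ)⁻¹) * ((n : ℝ) * ∑ v ∈ S, Real.log (absNorm v.asIdeal : ℝ)) := by
      rw [Finset.mul_sum, Finset.mul_sum]
      refine Finset.sum_le_sum_of_subset_of_nonneg (Finset.filter_subset _ _) fun v _ _ => ?_
      have he1 : (0 : ℝ) ≤ 1 - (e : ℝ)⁻¹ :=
        sub_nonneg.mpr (inv_le_one_of_one_le₀ (by exact_mod_cast he))
      exact mul_nonneg he1 (mul_nonneg (Nat.cast_nonneg _) (Real.log_nonneg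
        (Nat.one_le_cast.mpr (Nat.one_le_iff_ne_zero.mpr (absNorm_eq_zero_iff.not.mpr v.ne_bot)))))
    calc _ ≤ ∑ w ∈ T with χ w ∉ B, g' w := Finset.sum_le_sum h2
      _ = _ := hconc.symm.trans h3b
      _ ≤ ∑ v ∈ S', (1 - (e : ℝ)⁻¹) * ((n : ℝ) * Real.log (absNorm v.asIdeal : ℝ)) :=
          Finset.sum_le_sum h3c
      _ ≤ _ := h3d
  -- step 4: over `B`, `ord_w 𝔇 ≤ e_w − 1 + ord_w(e_w) ≤ ord_w(p_w) + ord_w(n!)` (Dedekind–Hensel)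
  have hbad_le : ∑ w ∈ T with χ w ∈ B, g w ≤
      finrank ℚ L * (∑ p ∈ B, Real.log (p : ℝ) + Real.log (n.factorial : ℝ)) := by
    let b₁ : HeightOneSpectrum (𝓞 L) → ℝ := fun w =>
      (multiplicity w.asIdeal (Ideal.span {((χ w : ℕ) : 𝓞 L)}) : ℝ) * Real.log (absNorm w.asIdeal : ℝ)
    let b₂ : HeightOneSpectrum (𝓞 L) → ℝ := fun w =>
      (multiplicity w.asIdeal (Ideal.span {((n.factorial : ℕ) : 𝓞 L)}) : ℝ) *
        Real.log (absNorm w.asIdeal : ℝ)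
    have h4a : ∀ w : HeightOneSpectrum (𝓞 L), g w ≤ b₁ w + b₂ w := by
      intro w
      haveI := hmax w
      rw [show b₁ w + b₂ w = (_ + _) * _ from (add_mul _ _ _).symm]
      refine mul_le_mul_of_nonneg_right ?_ (hlogN w)
      have hDH := Literature.NumberTheory.NumberFields.multiplicity_differentIdeal_succ_le K L w.asIdeal
      have hep : w.asIdeal.ramificationIdx (𝓞 K) ≤
          multiplicity w.asIdeal (Ideal.span {((χ w : ℕ) : 𝓞 L)}) := by
        rw [Literature.NumberTheory.NumberFields.multiplicity_span_residueChar L w.asIdeal]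
        exact Nat.le_of_dvd (Ideal.ramificationIdx_pos w.asIdeal ℤ)
          (Literature.NumberTheory.NumberFields.ramificationIdx_rel_dvd_ramificationIdx_int K L w.asIdeal)
      have hen : w.asIdeal.ramificationIdx (𝓞 K) ≤ n := by
        set v : HeightOneSpectrum (𝓞 K) := w.under (𝓞 K) with hv
        haveI : w.asIdeal.LiesOver v.asIdeal := ⟨rfl⟩
        haveI := v.isMaximal
        have hmem : w.asIdeal ∈ IsDedekindDomain.primesOverFinset v.asIdeal (𝓞 L) :=
          (IsDedekindDomain.mem_primesOverFinset_iff v.ne_bot _).mpr ⟨w.isPrime, inferInstance⟩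
        have hle := Finset.single_le_sum (f := fun P => ramificationIdx' v.asIdeal P *
          inertiaDeg' v.asIdeal P) (fun _ _ => Nat.zero_le _) hmem
        rw [Ideal.sum_ramification_inertia (R := 𝓞 K) (𝓞 L) K L v.ne_bot] at hle
        rw [← Ideal.ramificationIdx'_eq_ramificationIdx v.asIdeal w.asIdeal v.ne_bot]
        exact le_trans (Nat.le_mul_of_pos_right _ (Ideal.inertiaDeg'_pos v.asIdeal w.asIdeal)) hle
      have hfact := Literature.NumberTheory.NumberFields.multiplicity_span_natCast_mono L w.asIdeal
        (Nat.factorial_pos n).ne' (Nat.dvd_factorial (Ideal.ramificationIdx_pos w.asIdeal (𝓞 K)) hen)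
      have : (multiplicity w.asIdeal D : ℕ) ≤ multiplicity w.asIdeal (Ideal.span {((χ w : ℕ) : 𝓞 L)}) +
          multiplicity w.asIdeal (Ideal.span {((n.factorial : ℕ) : 𝓞 L)}) := by
        simp only [hD_def]; omega
      exact_mod_cast this
    have h4b : ∑ w ∈ T with χ w ∈ B, b₁ w ≤ finrank ℚ L * ∑ p ∈ B, Real.log (p : ℝ) := by
      rw [← Finset.sum_fiberwise_of_maps_to (s := T.filter fun w => χ w ∈ B) (t := B) (g := χ)
        (fun w hw => (Finset.mem_filter.mp hw).2), Finset.mul_sum]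
      refine Finset.sum_le_sum fun p _ => ?_
      rw [Finset.filter_filter]
      refine (Finset.sum_le_sum_of_subset_of_nonneg (Finset.monotone_filter_right T fun w _ hw => hw.2)
        fun w _ _ => mul_nonneg (Nat.cast_nonneg _) (hlogN w)).trans ?_
      refine (Finset.sum_le_sum fun w hw => ?_).trans (sum_filter_residueChar_mul_log_le L T p)
      rw [← (Finset.mem_filter.mp hw).2]
    have h4c : ∑ w ∈ T with χ w ∈ B, b₂ w ≤ finrank ℚ L * Real.log (n.factorial : ℝ) := by
      refine (Finset.sum_le_sum_of_subset_of_nonneg (Finset.filter_subset _ T) fun w _ _ =>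
        mul_nonneg (Nat.cast_nonneg _) (hlogN w)).trans ?_
      rw [← log_absNorm_span_natCast L n.factorial]
      exact sum_mul_log_le_log_absNorm L (by
        rw [Ne, Ideal.span_singleton_eq_bot]; exact_mod_cast (Nat.factorial_pos n).ne') T
    calc ∑ w ∈ T with χ w ∈ B, g w ≤ ∑ w ∈ T with χ w ∈ B, (b₁ w + b₂ w) :=
          Finset.sum_le_sum fun w _ => h4a w
      _ ≤ finrank ℚ L * ∑ p ∈ B, Real.log (p : ℝ) + finrank ℚ L * Real.log (n.factorial : ℝ) := by
          rw [Finset.sum_add_distrib]; exact add_le_add h4b h4c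
      _ = _ := by ring
  -- assemble, translate to log-discriminants and divide by `[L:ℚ] = [K:ℚ]·n`
  have hmain : Real.log (absNorm D : ℝ) ≤
      (1 - (e : ℝ)⁻¹) * ((n : ℝ) * ∑ v ∈ S, Real.log (absNorm v.asIdeal : ℝ)) +
        finrank ℚ L * (∑ p ∈ B, Real.log (p : ℝ) + Real.log (n.factorial : ℝ)) := by
    rw [h1, hsplit]; linarith
  have hdiff : (finrank ℚ L : ℝ)⁻¹ * Real.log ((discr L).natAbs : ℝ) -
      (finrank ℚ K : ℝ)⁻¹ * Real.log ((discr K).natAbs : ℝ) =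
        (finrank ℚ L : ℝ)⁻¹ * Real.log (absNorm D : ℝ) := by
    rw [hD_def, log_natAbs_discr_eq K L, ← hn_def, htower]
    field_simp
    ring
  rw [hdiff]
  refine (mul_le_mul_of_nonneg_left hmain (inv_nonneg.mpr hLpos.le)).trans (le_of_eq ?_)
  rw [htower]
  field_simp

end Engine

/-! ## Restatement for presented points (`NFPoint`) along a ring map -/

namespace NFPoint

/-- **[GenEll] Prop. 1.7 (i), right inequality in the printed shape
`log-diff_Y − log-diff_Z ≲ (1 − 1/e)·log-cond_E`**, for `Z = ℙ¹`, `E = C = [0]+[1]+[∞]` and a point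
`y ↦ x ∈ U_P` presented over a map of fields `f : P.F → Q.F`: if, outside the finite set `B` of residue
characteristics (print's `Σ`), the primes of the field of `y` are unramified over the field of `x`
except over the support of the conductor of `x`, where they are tamely ramified with index `≤ e`, then
`log-diff(y) − log-diff(x) ≤ (1 − 1/e)·log-cond_C(x) + (Σ_{p∈B} log p + log [Q.F:P.F]!)`.
[cite: MochizukiGenEll2010, Prop 1.7 (i) p.10] -/
theorem logDiff_sub_logDiff_le_one_sub_inv_mul_logCond (P Q : NFPoint) (f : P.F →+* Q.F)
    (hP : P.InU) (B : Finset ℕ) {e : ℕ} (he : 0 < e)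
    (hunr : letI : Algebra P.F Q.F := f.toAlgebra
      ∀ w : HeightOneSpectrum (𝓞 Q.F), absNorm (w.asIdeal.under ℤ) ∉ B →
        w.under (𝓞 P.F) ∉ P.condSupport → w.asIdeal.ramificationIdx (𝓞 P.F) = 1)
    (htame : letI : Algebra P.F Q.F := f.toAlgebra
      ∀ w : HeightOneSpectrum (𝓞 Q.F), absNorm (w.asIdeal.under ℤ) ∉ B →
        w.under (𝓞 P.F) ∈ P.condSupport → w.asIdeal.ramificationIdx (𝓞 P.F) ≤ e ∧
          ¬ (absNorm (w.asIdeal.under ℤ) ∣ w.asIdeal.ramificationIdx (𝓞 P.F))) :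
    letI : Algebra P.F Q.F := f.toAlgebra
    Q.logDiff - P.logDiff ≤
      (1 - (e : ℝ)⁻¹) * P.logCond +
        (∑ p ∈ B, Real.log (p : ℝ) + Real.log ((finrank P.F Q.F).factorial : ℝ)) := by
  letI : Algebra P.F Q.F := f.toAlgebra
  rw [P.logCond_eq_sum hP, logDiff_eq_log_discr, logDiff_eq_log_discr]
  exact logdisc_sub_logdisc_le_tame P.F Q.F (P.condSupport_finite hP).toFinset B he
    (fun w hB hS => hunr w hB fun h => hS ((P.condSupport_finite hP).mem_toFinset.mpr h))
    (fun w hB hS => htame w hB ((P.condSupport_finite hP).mem_toFinset.mp hS))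

end NFPoint

end Literature.NumberTheory.DiophantineGeometry.GenEll

end
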